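import Mathlib
import Literature.AlgebraicGeometry.Resolution.LocalBlowup
import Summits.ResolutionOfSingularities.ResolutionOfSingularities.Theorems.FrobeniusClosingSteerShannonCoarseningLemmas
import Summits.ResolutionOfSingularities.ResolutionOfSingularities.Theorems.ValuativeLuAlphaPTorsorAPTorsion
import HarnessLib

/-!
# Route `RadicialJung`, crux `CleanModels` (stmt-15917) — (C-curve) sub-line, brick S1a/S1b: the rebasing field `k(t)` sits inside the local ring at the
# centre of the coarsening

Lead `res-B-lead-1` g6 (plan `Cruxes/CleanModels/Lines/Sketch-memo-Ccurve-plan.md` §1 S1; second quarter of `stub_Cc_rebaseD2`).  OURS · counted 0.  Nothing here proves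
resolution in characteristic `p`; resolution in char `p` is NOT proved.

For valuation rings `O ≤ O₁` of `K`, a `k`-subalgebra `B ⊆ O` and `t ∈ B` with `v(t) > 0` but `v₁(t) = 0` (an `O₁`-unit in the maximal ideal of `O`, ✓
`Ccurve.exists_mem_maximalIdeal_valuation_eq_one`):
* `valuation_aeval_eq_one` (S1a) — `t` is RESIDUALLY TRANSCENDENTAL for `O₁`: every non-zero `q ∈ k[X]` has `v₁(q(t)) = 0` (write `q = X^m r`, `r(0) ≠ 0`; then `r(t)` is a
  unit of `O`, hence of `O₁`);
* `mem_locAtCentre_of_mem_adjoin_simple` (S1b) — hence the field `k⟮t⟯ ⊆ K` lies inside `locAtCentre B O₁` (its elements are `r(t)/s(t)` with `s(t)` an `O₁`-unit of `B`).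
Helper: `valuation_lt_one_of_le` (non-units of `O₁` inside `O`); units: ✓ `Shannon.valuation_eq_one_of_le`, constants: ✓ `PfaffLine.ap_valuation_algebraMap_eq_one`.
-/

noncomputable section

set_option linter.dupNamespace false

open IsLocalRing Polynomial
open Literature.AlgebraicGeometry.Resolution
open Summit.ResolutionOfSingularities.ResolutionOfSingularities.Theorems.SwitchingDichotomy
open Summit.ResolutionOfSingularities.ResolutionOfSingularities.Theorems

namespace Summit.ResolutionOfSingularities.ResolutionOfSingularities.Theorems.RadicialJung.CleanModels.Ccurve

variable {K : Type} [Field K]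

/-- An element of `O` lying in the maximal ideal of a coarsening `O₁ ≥ O` lies in the maximal ideal of `O`. [folklore] -/
theorem valuation_lt_one_of_le {O O₁ : ValuationSubring K} (hOO₁ : O ≤ O₁) {x : K} (hxO : x ∈ O) (hx : O₁.valuation x < 1) :
    O.valuation x < 1 := by
  by_contra h
  have h1 : O.valuation x = 1 := le_antisymm ((O.valuation_le_one_iff x).mpr hxO) (not_lt.mp h)
  exact (lt_irrefl _) (Shannon.valuation_eq_one_of_le hOO₁ h1 ▸ hx)

variable {k : Type} [Field k] [Algebra k K]

/-- **S1a: an `O₁`-unit in the maximal ideal of `O` is residually transcendental over `k` for `O₁`**: for `t ∈ B ⊆ O` (`B` a `k`-subalgebra) with `v(t) > 0`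
and `v₁(t) = 0`, every non-zero `q ∈ k[X]` satisfies `v₁(q(t)) = 0`, i.e. `q(t)` is a unit of `O₁`. [folklore] -/
theorem valuation_aeval_eq_one (O O₁ : ValuationSubring K) (hOO₁ : O ≤ O₁) (B : Subalgebra k K) (hBO : B.toSubring ≤ O.toSubring)
    (t : K) (htB : t ∈ B) (hvt : O.valuation t < 1) (hv₁t : O₁.valuation t = 1) (q : k[X]) (hq : q ≠ 0) :
    O₁.valuation (aeval t q) = 1 := by
  have hk : ∀ c : k, algebraMap k K c ∈ O := fun c => hBO (B.algebraMap_mem c)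
  have hBmem : ∀ r : k[X], aeval t r ∈ B := fun r =>
    (Algebra.adjoin_le (Set.singleton_subset_iff.mpr htB) : Algebra.adjoin k {t} ≤ B) (aeval_mem_adjoin_singleton k t)
  -- `q = X^m · r` with `r(0) ≠ 0`
  obtain ⟨r, hqr, hr⟩ := exists_eq_pow_rootMultiplicity_mul_and_not_dvd q hq 0
  rw [map_zero, sub_zero] at hqr hr
  have hr0 : r.coeff 0 ≠ 0 := fun h => hr (X_dvd_iff.mpr h)
  -- `r = C r₀ + X · r'`
  obtain ⟨r', hr'⟩ : X ∣ r - C (r.coeff 0) := X_dvd_iff.mpr (by simp)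
  have hr_eval : aeval t r = algebraMap k K (r.coeff 0) + t * aeval t r' := by
    have : r = C (r.coeff 0) + X * r' := by rw [← hr']; ring
    conv_lhs => rw [this]
    simp [aeval_C, aeval_X]
  -- `r(t)` is a unit of `O`
  have hvr : O.valuation (aeval t r) = 1 := by
    rw [hr_eval]
    have hc : O.valuation (algebraMap k K (r.coeff 0)) = 1 := PfaffLine.ap_valuation_algebraMap_eq_one O hk hr0
    have hlt : O.valuation (t * aeval t r') < O.valuation (algebraMap k K (r.coeff 0)) := by
      rw [hc, map_mul]
      calc O.valuation t * O.valuation (aeval t r') ≤ O.valuation t * 1 := by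
            gcongr; exact (O.valuation_le_one_iff _).mpr (hBO (hBmem r'))
        _ < 1 := by rw [mul_one]; exact hvt
    rw [Valuation.map_add_eq_of_lt_left _ hlt, hc]
  -- hence of `O₁`, and so is `t^m`
  rw [hqr, map_mul, map_pow, aeval_X, map_mul, map_pow, hv₁t, one_pow, one_mul]
  exact Shannon.valuation_eq_one_of_le hOO₁ hvr

/-- **S1b: the rebasing field `k⟮t⟯` lies inside `locAtCentre B O₁`**: every element of `IntermediateField.adjoin k {t}` is `r(t)/s(t)` with `r(t), s(t) ∈ B` and
`s(t)` an `O₁`-unit (or `s(t) = 0`, when the element is `0`). [folklore] -/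
theorem mem_locAtCentre_of_mem_adjoin_simple (O O₁ : ValuationSubring K) (hOO₁ : O ≤ O₁) (B : Subalgebra k K) (hBO : B.toSubring ≤ O.toSubring)
    (t : K) (htB : t ∈ B) (hvt : O.valuation t < 1) (hv₁t : O₁.valuation t = 1)
    {x : K} (hx : x ∈ IntermediateField.adjoin k ({t} : Set K)) : x ∈ locAtCentre B.toSubring O₁ := by
  have hBmem : ∀ r : k[X], aeval t r ∈ B := fun r =>
    (Algebra.adjoin_le (Set.singleton_subset_iff.mpr htB) : Algebra.adjoin k {t} ≤ B) (aeval_mem_adjoin_singleton k t)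
  obtain ⟨r, s, rfl⟩ := (IntermediateField.mem_adjoin_simple_iff k x).mp hx
  by_cases hs : s = 0
  · rw [hs, map_zero, div_zero]; exact Subring.zero_mem _
  · exact ⟨aeval t r, hBmem r, aeval t s, hBmem s, valuation_aeval_eq_one O O₁ hOO₁ B hBO t htB hvt hv₁t s hs, rfl⟩

end Summit.ResolutionOfSingularities.ResolutionOfSingularities.Theorems.RadicialJung.CleanModels.Ccurve

end
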